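import Summits.ValiantsHypothesis.ValiantsHypothesis.Theorems.BarrierLeverNaturalProofsAgainstAllLinearSizesOfCountSize
import Literature.ModelTheory.FiniteModelTheory.SymmetricCircuitCountingWidthProofs

/-!
# Route BarrierLever — item `NaturalProofsAgainstAllLinearSizesOfCount` (stmt-ValiantsHypothesis-19261),
# part 3/3: the arithmetic, and the item — Baur–Strassen is poly(N)-natural against EVERY linear
# size `c·n`, conditionally on the generic gradient fibre count

Continuation of `…OfCountCertificate.lean` / `…OfCountSize.lean`. With `k n = 3cn/(log₂(n-1)-1) + 1`
restricted variables, `n₀ = 2^(6c+3)+1` and `a = 7(12c+4)+11 = 84c+39` (crude constants; cell memo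
ROUTE-MEMO-p2-g4 §3): `arith_core` discharges `1 ≤ n`, `k n ≤ n`, `2^(k n + 3cn) < (n-1)^(k n)` and
`R ≤ binom(2n,n)^(12c+4)`; `size_arith` turns `R ≤ B^a₁, N ≤ B` into the two size inequalities;
`naturalProofsAgainstAllLinearSizes_of_AG` = item 20156's conclusion from the single hypothesis
`∀ k, ∀ d ≥ 3, GenericGradientFibreCount k d`; and **`naturalProofsAgainstAllLinearSizesOfCount`** =
the signature of item stmt-ValiantsHypothesis-19261 VERBATIM (hypothesis = item stmt-19256
`GradientGenericFibreCount` inlined; conclusion = item stmt-20156 `NaturalProofsAgainstAllLinearSizes`).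

Reading: for every linear size bound `c·n` there is ONE level `a = 84c+39` at which the coefficient
vectors of degree-`≤ n`, size-`≤ c·n` polynomials are NOT a hitting set for `Distinguishers ℂ n a` —
an algebraically natural proof (Baur–Strassen's, packaged as the Macaulay determinant of the
gradient of a restricted top form) exists against all linear sizes, modulo the AG count. Method
ceiling `Θ(a·n)`: this says nothing about size `n^b`, `b ≥ 2`, i.e. nothing about FSV Question 6.

Lean text authored by the cell planner seat `valiant-natproofs-p2` (gen 4, HOME/NaturalBSAll-p2g4.lean
`filedConditional_holds`, referee REF-G11 / REF-G13 §5 PASS), ported by the prover seat.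

WHAT THIS IS NOT: CONDITIONAL on the AG count (item stmt-19256, separately proved in scratch by
p2-g4, port pending); not a statement about polynomial sizes `n^b`, `b ≥ 2`; nothing on crux
stmt-14610 or `VP` vs `VNP`.

References: Baur–Strassen 1983; Strassen 1973 (degree bound); [CoxLittleOSheaUsing2005] Ch. 3.
-/

-- layout Summits/ValiantsHypothesis/ValiantsHypothesis forces the duplicated namespace component
set_option linter.dupNamespace false

noncomputable section

open MvPolynomial Finset

namespace Summit.ValiantsHypothesis.ValiantsHypothesis.Theorems.BarrierLever.NaturalProofsAgainstAllLinearSizes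

open Literature.Computability.AlgebraicComplexity
open Literature.Computability.AlgebraicComplexity.DegreeBound Literature.RingTheory.MvPolynomial.Macaulay
open Literature.Barriers.ValiantsHypothesis

section arithmetic

/-- `N = #degLEMonomials n ≤ binom(2n, n)` (in fact `=`; slack-variable injection into the
degree-`n` monomials in `n+1` variables). -/
theorem card_degLEMonomials_le_choose (n : ℕ) :
    Fintype.card (degLEMonomials n) ≤ (2 * n).choose n := by
  classical
  let ext : degLEMonomials n → ((Finset.univ : Finset (Fin (n + 1))).finsuppAntidiag n) := fun m =>
    ⟨m.1.mapDomain Fin.castSucc + Finsupp.single (Fin.last n) (n - m.1.degree), by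
      rw [Finset.mem_finsuppAntidiag]
      refine ⟨?_, Finset.subset_univ _⟩
      have hm : m.1.degree ≤ n := m.2
      rw [← Finsupp.degree_eq_sum, map_add, Finsupp.degree_mapDomain, Finsupp.degree_single]
      omega⟩
  have hinj : Function.Injective ext := by
    intro m₁ m₂ h
    have h' := congrArg (fun x => (x.1 : Fin (n + 1) →₀ ℕ)) h
    simp only [ext] at h'
    apply Subtype.ext
    ext i
    have := congrArg (fun x : Fin (n + 1) →₀ ℕ => x (Fin.castSucc i)) h'
    simpa [Finsupp.mapDomain_apply (Fin.castSucc_injective _), Finsupp.single_apply,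
      (Fin.castSucc_lt_last i).ne'] using this
  calc Fintype.card (degLEMonomials n)
      ≤ Fintype.card ((Finset.univ : Finset (Fin (n + 1))).finsuppAntidiag n) :=
        Fintype.card_le_of_injective ext hinj
    _ = (2 * n).choose n := by
      rw [Fintype.card_coe, Finset.card_finsuppAntidiag_nat_eq_choose, Finset.card_univ,
        Fintype.card_fin]
      congr 1
      omega

/-- `#mons k D = binom(k + D - 1, D)`. -/
theorem card_mons (k D : ℕ) : (mons k D).card = (k + D - 1).choose D := by
  rw [mons, Finset.card_finsuppAntidiag_nat_eq_choose, Finset.card_univ, Fintype.card_fin]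

/-- `R = binom(k(n-1), k-1) ≤ n^(2k)`. -/
theorem card_mons_critDeg_le {k n : ℕ} (hk1 : 1 ≤ k) (hkn : k ≤ n) (hn : 2 ≤ n) :
    (mons k (critDeg k (n - 1))).card ≤ n ^ (2 * k) := by
  rw [card_mons]
  obtain ⟨m, rfl⟩ : ∃ m, n = m + 2 := ⟨n - 2, by omega⟩
  obtain ⟨j, rfl⟩ : ∃ j, k = j + 1 := ⟨k - 1, by omega⟩
  have hD : (j + 1) + critDeg (j + 1) (m + 2 - 1) - 1 = (j + 1) * (m + 1) := by
    unfold critDeg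
    have e1 : m + 2 - 1 - 1 = m := by omega
    rw [e1, show (j + 1) + ((j + 1) * m + 1) - 1 = (j + 1) + (j + 1) * m by omega]
    ring
  rw [hD]
  have hcd : critDeg (j + 1) (m + 2 - 1) = (j + 1) * (m + 1) - j := by
    unfold critDeg
    have e1 : m + 2 - 1 - 1 = m := by omega
    rw [e1]
    have : (j + 1) * (m + 1) = (j + 1) * m + (j + 1) := by ring
    omega
  rw [hcd, Nat.choose_symm (by nlinarith)]
  calc ((j + 1) * (m + 1)).choose j ≤ ((j + 1) * (m + 1)) ^ j := Nat.choose_le_pow _ _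
    _ ≤ ((m + 2) * (m + 2)) ^ j := Nat.pow_le_pow_left (Nat.mul_le_mul (by omega) (by omega)) _
    _ ≤ ((m + 2) * (m + 2)) ^ (j + 1) := Nat.pow_le_pow_right (by positivity) (by omega)
    _ = (m + 2) ^ (2 * (j + 1)) := by rw [← pow_two, ← pow_mul]

/-- The bookkeeping from `R ≤ B^a₁`, `N ≤ B`, `2 ≤ B` to the two size inequalities. -/
theorem size_arith {R N B a₁ : ℕ} (hB : 2 ≤ B) (hR : R ≤ B ^ a₁) (hN : N ≤ B) :
    8 * (R + 1) ^ 7 + R ^ 2 * (2 * N) ≤ B ^ (7 * a₁ + 11) ∧ R ≤ B ^ (7 * a₁ + 11) := by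
  have hP : 1 ≤ B ^ a₁ := Nat.one_le_pow _ _ (by omega)
  have hB1 : 0 < B := by omega
  have h1 : 8 * (R + 1) ^ 7 ≤ B ^ (7 * a₁ + 10) := by
    calc 8 * (R + 1) ^ 7 ≤ 8 * (2 * B ^ a₁) ^ 7 :=
          Nat.mul_le_mul_left _ (Nat.pow_le_pow_left (by omega) 7)
      _ = 2 ^ 10 * (B ^ a₁) ^ 7 := by ring
      _ ≤ B ^ 10 * (B ^ a₁) ^ 7 := Nat.mul_le_mul_right _ (Nat.pow_le_pow_left hB 10)
      _ = B ^ (7 * a₁ + 10) := by ring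
  have h2 : R ^ 2 * (2 * N) ≤ B ^ (7 * a₁ + 10) := by
    calc R ^ 2 * (2 * N) ≤ (B ^ a₁) ^ 2 * (B * B) :=
          Nat.mul_le_mul (Nat.pow_le_pow_left hR 2) (Nat.mul_le_mul hB hN)
      _ = B ^ (2 * a₁ + 2) := by ring
      _ ≤ B ^ (7 * a₁ + 10) := Nat.pow_le_pow_right hB1 (by omega)
  refine ⟨?_, hR.trans (Nat.pow_le_pow_right hB1 (by omega))⟩
  calc 8 * (R + 1) ^ 7 + R ^ 2 * (2 * N) ≤ 2 * B ^ (7 * a₁ + 10) := by omega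
    _ ≤ B * B ^ (7 * a₁ + 10) := Nat.mul_le_mul_right _ hB
    _ = B ^ (7 * a₁ + 11) := by ring

/-- The number of restricted variables: `k n = 3cn / (log₂(n-1) - 1) + 1`. -/
def kOf (c n : ℕ) : ℕ := 3 * c * n / (Nat.log 2 (n - 1) - 1) + 1

/-- The three "lower-bound side" inequalities and the bound `R ≤ binom(2n,n)^(12c+4)`. -/
theorem arith_core (c n : ℕ) (hn : 2 ^ (6 * c + 3) + 1 ≤ n) :
    1 ≤ n ∧ kOf c n ≤ n ∧ 2 ^ (kOf c n + 3 * (c * n)) < (n - 1) ^ kOf c n ∧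
      (mons (kOf c n) (critDeg (kOf c n) (n - 1))).card ≤ ((2 * n).choose n) ^ (12 * c + 4) := by
  have h8 : 8 ≤ 2 ^ (6 * c + 3) := by
    calc (8 : ℕ) = 2 ^ 3 := by norm_num
      _ ≤ 2 ^ (6 * c + 3) := Nat.pow_le_pow_right (by norm_num) (by omega)
  have hn2 : 2 ≤ n := by omega
  set L := Nat.log 2 (n - 1) with hLdef
  have hL : 6 * c + 3 ≤ L := Nat.le_log_of_pow_le (by norm_num) (by omega)
  have hLpow : 2 ^ L ≤ n - 1 := Nat.pow_log_le_self 2 (by omega)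
  have hnlt : n - 1 < 2 ^ (L + 1) := Nat.lt_pow_succ_log_self (by norm_num) (n - 1)
  have hLn : L ≤ n - 1 := (Nat.lt_two_pow_self).le.trans hLpow
  obtain ⟨M, hM⟩ : ∃ M, L = M + 1 := ⟨L - 1, by omega⟩
  have hM2 : 6 * c + 2 ≤ M := by omega
  have hk : kOf c n = 3 * c * n / M + 1 := by
    simp only [kOf, ← hLdef, hM, Nat.add_sub_cancel]
  set q := 3 * c * n / M with hq
  have hq1 : q * M ≤ 3 * c * n := Nat.div_mul_le_self _ _
  have hq2 : 3 * c * n < M * (q + 1) := Nat.lt_mul_div_succ _ (by omega)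
  rw [hk]
  refine ⟨by omega, ?_, ?_, ?_⟩
  · -- k ≤ n
    have h3 : 3 * c * n ≤ (n - 1) * M := by
      calc 3 * c * n ≤ 3 * c * (2 * (n - 1)) := Nat.mul_le_mul_left _ (by omega)
        _ = (6 * c) * (n - 1) := by ring
        _ ≤ M * (n - 1) := Nat.mul_le_mul_right _ (by omega)
        _ = (n - 1) * M := by ring
    have h4 : q ≤ n - 1 := Nat.le_of_mul_le_mul_right (hq1.trans h3) (by omega)
    omega
  · -- 2^(k+3cn) < (n-1)^k
    have hexp : (q + 1) + 3 * (c * n) < L * (q + 1) := by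
      rw [hM]
      have : (M + 1) * (q + 1) = M * (q + 1) + (q + 1) := by ring
      rw [this]
      have : 3 * (c * n) = 3 * c * n := by ring
      omega
    calc 2 ^ ((q + 1) + 3 * (c * n)) < 2 ^ (L * (q + 1)) := Nat.pow_lt_pow_right (by norm_num) hexp
      _ = (2 ^ L) ^ (q + 1) := pow_mul _ _ _
      _ ≤ (n - 1) ^ (q + 1) := Nat.pow_le_pow_left hLpow _
  · -- R ≤ binom(2n,n)^(12c+4)
    have hkn : q + 1 ≤ n := by
      have h3 : 3 * c * n ≤ (n - 1) * M := by
        calc 3 * c * n ≤ 3 * c * (2 * (n - 1)) := Nat.mul_le_mul_left _ (by omega)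
          _ = (6 * c) * (n - 1) := by ring
          _ ≤ M * (n - 1) := Nat.mul_le_mul_right _ (by omega)
          _ = (n - 1) * M := by ring
      have h4 : q ≤ n - 1 := Nat.le_of_mul_le_mul_right (hq1.trans h3) (by omega)
      omega
    have hexp : (L + 1) * (2 * (q + 1)) ≤ (12 * c + 4) * n := by
      -- (L+1) ≤ 2M; M(q+1) = Mq + M ≤ 3cn + n
      have e1 : L + 1 ≤ 2 * M := by omega
      have e2 : M * (q + 1) ≤ 3 * c * n + n := by
        have : M * (q + 1) = q * M + M := by ring
        rw [this]
        have : M ≤ n := by omega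
        omega
      calc (L + 1) * (2 * (q + 1)) ≤ (2 * M) * (2 * (q + 1)) := Nat.mul_le_mul_right _ e1
        _ = 4 * (M * (q + 1)) := by ring
        _ ≤ 4 * (3 * c * n + n) := Nat.mul_le_mul_left _ e2
        _ = (12 * c + 4) * n := by ring
    calc (mons (q + 1) (critDeg (q + 1) (n - 1))).card ≤ n ^ (2 * (q + 1)) :=
          card_mons_critDeg_le (Nat.le_add_left 1 q) hkn hn2
      _ ≤ (2 ^ (L + 1)) ^ (2 * (q + 1)) := Nat.pow_le_pow_left (by omega) _
      _ = 2 ^ ((L + 1) * (2 * (q + 1))) := (pow_mul _ _ _).symm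
      _ ≤ 2 ^ ((12 * c + 4) * n) := Nat.pow_le_pow_right (by norm_num) hexp
      _ = (2 ^ n) ^ (12 * c + 4) := by rw [mul_comm, pow_mul]
      _ ≤ ((2 * n).choose n) ^ (12 * c + 4) := Nat.pow_le_pow_left (Literature.ModelTheory.FiniteModelTheory.two_pow_le_choose_two_mul_self n) _

end arithmetic

/-- **ITEM 20156 modulo the AG count alone.** The statement proved is VERBATIM the signature of
`Summit.ValiantsHypothesis.ValiantsHypothesis.Theses.BarrierLever.NaturalProofsAgainstAllLinearSizes`
(with `a = 84c + 39`, `n₀ = 2^(6c+3) + 1`), from the single hypothesis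
`∀ k, ∀ d ≥ 3, GenericGradientFibreCount k d` (CLO *Using AG* Ch. 3 Thm. (5.5) + generic
smoothness, Hartshorne III Cor. 10.7 — to be landed as a named Literature fact or proved). -/
theorem naturalProofsAgainstAllLinearSizes_of_AG
    (hAG : ∀ k d : ℕ, 3 ≤ d → GenericGradientFibreCount k d) :
    ∀ c : ℕ, ∃ a n₀ : ℕ, ∀ n ≥ n₀,
      ¬ IsSuccinctHittingSet (degLEMonomials n)
          {f : MvPolynomial (Fin n) ℂ | f.totalDegree ≤ n ∧ complexity f ≤ c * n}
          (Distinguishers ℂ n a) := by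
  intro c
  refine ⟨7 * (12 * c + 4) + 11, 2 ^ (6 * c + 3) + 1, ?_⟩
  have h8 : 8 ≤ 2 ^ (6 * c + 3) := by
    calc (8 : ℕ) = 2 ^ 3 := by norm_num
      _ ≤ 2 ^ (6 * c + 3) := Nat.pow_le_pow_right (by norm_num) (by omega)
  refine naturalProofsAgainstLinearSize_of_AG_and_arith c _ _ (kOf c)
    (fun n hn => hAG _ _ (by omega)) (fun n hn => ?_) (fun n hn => ?_)
  · obtain ⟨h1, h2, h3, -⟩ := arith_core c n hn
    exact ⟨h1, h2, h3⟩
  · obtain ⟨h1, -, -, h4⟩ := arith_core c n hn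
    have hB : 2 ≤ (2 * n).choose n := by
      calc 2 = 2 ^ 1 := by norm_num
        _ ≤ 2 ^ n := Nat.pow_le_pow_right (by norm_num) h1
        _ ≤ (2 * n).choose n := Literature.ModelTheory.FiniteModelTheory.two_pow_le_choose_two_mul_self n
    exact size_arith hB h4 (card_degLEMonomials_le_choose n)

/-- **Item `NaturalProofsAgainstAllLinearSizesOfCount` (stmt-ValiantsHypothesis-19261), signature
verbatim**: the generic gradient fibre count (item stmt-19256, inlined as the hypothesis) implies
that for every `c` there are `a, n₀` with `coeff(deg ≤ n, size ≤ c·n)` NOT a hitting set for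
`Distinguishers ℂ n a`, all `n ≥ n₀` (item stmt-20156's statement). Proof:
`naturalProofsAgainstAllLinearSizes_of_AG` (the hypothesis is `∀ k d, 3 ≤ d →
GenericGradientFibreCount k d` by `Iff.rfl`). -/
theorem naturalProofsAgainstAllLinearSizesOfCount :
    (∀ k d : ℕ, 3 ≤ d → ∀ g : MvPolynomial (Fin k) ℂ, g.totalDegree ≤ d → (∀ ξ : Fin k → ℂ, (∀ i, MvPolynomial.eval ξ (MvPolynomial.pderiv i (MvPolynomial.homogeneousComponent d g)) = 0) → ξ = 0) → ∃ c : Fin k → ℂ, {x : Fin k → ℂ | ∀ i, MvPolynomial.eval x (MvPolynomial.pderiv i g) = c i}.Finite ∧ (d - 1) ^ k ≤ {x : Fin k → ℂ | ∀ i, MvPolynomial.eval x (MvPolynomial.pderiv i g) = c i}.ncard) → ∀ c : ℕ, ∃ a n₀ : ℕ, ∀ n ≥ n₀, ¬ Literature.Barriers.ValiantsHypothesis.IsSuccinctHittingSet (Literature.Barriers.ValiantsHypothesis.degLEMonomials n) {f : MvPolynomial (Fin n) ℂ | f.totalDegree ≤ n ∧ Literature.Computability.AlgebraicComplexity.complexity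 f ≤ c * n} (Literature.Barriers.ValiantsHypothesis.Distinguishers ℂ n a) :=
  fun hAG => naturalProofsAgainstAllLinearSizes_of_AG hAG

end Summit.ValiantsHypothesis.ValiantsHypothesis.Theorems.BarrierLever.NaturalProofsAgainstAllLinearSizes

end
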